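import Summits.ValiantsHypothesis.ValiantsHypothesis.Theorems.BarrierLeverAnchoredDoorHitsLowerPairsP2Reduction

/-!
# Support item `AnchoredDoorHitsLowerPairs` (stmt-ValiantsHypothesis-22510), line `anchored-peeling`:
# THE LABELLED PROFILE-2 DOMINANT PROBLEM — block-door form of `P2.p2Entry` with EXPONENTIAL LABELS, functoriality in the coefficient ring,
# the bridge `entry (∅, W) = p2Entry W`, and generic simultaneity (part 1 of the x-elimination recursion for Conjecture Z)

Helper file (`--supports stmt-ValiantsHypothesis-22510`; cell valiant-natproofs, rung V4, 𝒟-side door (c); registered line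
`Cruxes/AnchoredDoorHitsLowerPairs/Lines/anchored_peeling.lean` v26; node `Stmt.stub_conjZ` of `…ConjZ` (p695484); prover seat val-np-p1 gen 26;
memo HOME/val-np-p1/g26/MEMO-conjZ-node-valnp1-g26.md §3–§4 and lab/xcert2.py). Closes NO item.

WHAT. The x-elimination recursion certifying `det (P2.p2Entry Θ Φ (w j) (u i)) ≠ 0` (hence `symbolicDet 2 ≠ 0`, K1 p692620) runs on a LARGER class of
columns: a column is a pair `c = (L, W)` of a set `L` of LABELS (anchors `ℓ`, each standing for a pure exponential `E_ℓ = ∏_b (1 + Ψ ℓ b · x_b)` with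
its own tail parameters `Ψ`) and a vertex set `W`; its element is `colE Θ Φ Ψ c = (∏_{ℓ ∈ L} E_ℓ) · t_W` with
`t_W = Σ_{J ∈ jSet W} Θ^J · ∏_{α ∈ J} (x^{A_α} ∏_{b ∉ A_α}(1 + Φ α b · x_b))` — the sum over the anchor sets of profile 2 whose `y`-parts partition `W` with the
maximum number `⌊|W|/2⌋` of pairs (exactly the index set of `P2.p2Entry`) — and its reading on the row `U` is `entry Θ Φ Ψ U c = [x^U] colE`. Everything is
defined over an arbitrary commutative ring `K` of parameters (`map_colE`: functorial), so that the same objects serve over `ℂ`, over `ℂ[λ]` (the dominance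
scale of the step) and over the symbolic parameter ring `ℂ[Param h]` (generic simultaneity).

* `entry_empty_labels` (**bridge**): over `ℂ`, `entry Θ Φ Ψ U (∅, W) = P2.p2Entry Θ Φ W U` (via `AnchorSets.xcoeff_eq` at the point `phiPoint Φ`).
* `lmat` (the labelled matrix of a pair of enumerations), `eval_det_lmatS` (its determinant is the evaluation of the symbolic one), and
  **`exists_common_point`**: two enumerated square systems, each nonsingular for SOME parameters, are nonsingular for COMMON parameters
  (product of two nonzero polynomials over `ℂ`, `MvPolynomial.funext`).

WHAT THIS IS NOT: no step of the recursion yet (sequel files `…XElimSplit`, `…XElimStep`, `…XElimRecursion`); nothing on crux stmt-ValiantsHypothesis-14610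
or on `VP` versus `VNP`.
-/

set_option linter.dupNamespace false

namespace Summit.ValiantsHypothesis.ValiantsHypothesis.Theorems.BarrierLever.AnchoredPeeling

open Finset MvPolynomial
open Summit.ValiantsHypothesis.ValiantsHypothesis.Theorems.BarrierLever.BrickCalculus (pexpo pexpo_def pexpo_le_iff pexpo_sub
  pexpo_apply_castAdd pexpo_apply_natAdd)

noncomputable section

/-- Anchors `(A | B)`: the index type of the door parameters. -/
abbrev Anchor (h : ℕ) : Type := Finset (Fin h) × Finset (Fin h)

/-- Labelled columns `(L, W)`: a set of labels (anchors standing for pure exponentials) and a column vertex set. -/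
abbrev LCol (h : ℕ) : Type := Finset (Anchor h) × Finset (Fin h)

namespace XElim

variable {h : ℕ} {K : Type*} [CommRing K]

/-! ## 1. The labelled column elements over a parameter ring `K` -/

section Defs

variable (Θ : Anchor h → K) (Φ Ψ : Anchor h → Fin h → K)

/-- The tail product of the anchor `α = (A | B)`: `∏_{b ∉ A} (1 + Φ α b · x_b)`. -/
def tailE (α : Anchor h) : MvPolynomial (Fin (h + h)) K :=
  ∏ b ∈ univ \ α.1, (1 + C (Φ α b) * X (Fin.castAdd h b))

/-- The `x`-part of the anchor `α`: `x^A · ∏_{b ∉ A} (1 + Φ α b · x_b)` (the evaluated `AnchorSets.xPart`). -/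
def xPartE (α : Anchor h) : MvPolynomial (Fin (h + h)) K :=
  (∏ a ∈ α.1, X (Fin.castAdd h a)) * tailE Φ α

/-- The exponential of the label `ℓ`: `E_ℓ = ∏_b (1 + Ψ ℓ b · x_b)` (all `x`-variables). -/
def labE (ℓ : Anchor h) : MvPolynomial (Fin (h + h)) K :=
  ∏ b : Fin h, (1 + C (Ψ ℓ b) * X (Fin.castAdd h b))

open Classical in
/-- The anchor sets of the dominant entry of the column `W`: subsets of `anchors 2 h` whose `y`-parts partition `W` with `⌊|W|/2⌋` pairs. -/
def jSet (W : Finset (Fin h)) : Finset (Finset (Anchor h)) :=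
  ((anchors 2 h).powerset).filter (fun J => P2.YPart W J ∧ P2.nPairs J = W.card / 2)

/-- The maximum-matching element of the column `W`: `t_W = Σ_{J ∈ jSet W} Θ^J · ∏_{α ∈ J} xPartE α`. -/
def tW (W : Finset (Fin h)) : MvPolynomial (Fin (h + h)) K :=
  ∑ J ∈ jSet W, C (∏ α ∈ J, Θ α) * ∏ α ∈ J, xPartE Φ α

/-- The labelled column element `E_L · t_W`. -/
def colE (c : LCol h) : MvPolynomial (Fin (h + h)) K :=
  (∏ ℓ ∈ c.1, labE Ψ ℓ) * tW Θ Φ c.2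

/-- Its reading on the row face `U`: `[x^U] (E_L · t_W)`. -/
def entry (U : Finset (Fin h)) (c : LCol h) : K :=
  coeff (pexpo U ∅) (colE Θ Φ Ψ c)

end Defs

/-! ## 2. Functoriality in the parameter ring -/

section Map

variable {K' : Type*} [CommRing K'] (f : K →+* K') (Θ : Anchor h → K) (Φ Ψ : Anchor h → Fin h → K)

/-- Functoriality of the tail product. -/
theorem map_tailE (α : Anchor h) : MvPolynomial.map f (tailE Φ α) = tailE (fun α b => f (Φ α b)) α := by
  rw [tailE, tailE, map_prod]
  refine Finset.prod_congr rfl (fun b _ => ?_)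
  rw [map_add, map_one, map_mul, map_C, map_X]

/-- Functoriality of the `x`-part. -/
theorem map_xPartE (α : Anchor h) : MvPolynomial.map f (xPartE Φ α) = xPartE (fun α b => f (Φ α b)) α := by
  rw [xPartE, xPartE, map_mul, map_prod, map_tailE]
  congr 1
  exact Finset.prod_congr rfl (fun a _ => map_X _ _)

/-- Functoriality of the label exponential. -/
theorem map_labE (ℓ : Anchor h) : MvPolynomial.map f (labE Ψ ℓ) = labE (fun ℓ b => f (Ψ ℓ b)) ℓ := by
  rw [labE, labE, map_prod]
  refine Finset.prod_congr rfl (fun b _ => ?_)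
  rw [map_add, map_one, map_mul, map_C, map_X]

/-- Functoriality of the maximum-matching element. -/
theorem map_tW (W : Finset (Fin h)) : MvPolynomial.map f (tW Θ Φ W) = tW (fun α => f (Θ α)) (fun α b => f (Φ α b)) W := by
  rw [tW, tW, map_sum]
  refine Finset.sum_congr rfl (fun J _ => ?_)
  rw [map_mul, map_C, map_prod, map_prod, map_prod]
  congr 1
  exact Finset.prod_congr rfl (fun α _ => map_xPartE f Φ α)

/-- **Functoriality of the column element.** -/
theorem map_colE (c : LCol h) :
    MvPolynomial.map f (colE Θ Φ Ψ c) = colE (fun α => f (Θ α)) (fun α b => f (Φ α b)) (fun ℓ b => f (Ψ ℓ b)) c := by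
  rw [colE, colE, map_mul, map_prod, map_tW]
  congr 1
  exact Finset.prod_congr rfl (fun ℓ _ => map_labE f Ψ ℓ)

/-- **Functoriality of the entries.** -/
theorem map_entry (U : Finset (Fin h)) (c : LCol h) :
    f (entry Θ Φ Ψ U c) = entry (fun α => f (Θ α)) (fun α b => f (Φ α b)) (fun ℓ b => f (Ψ ℓ b)) U c := by
  rw [entry, entry, ← map_colE, coeff_map]

end Map

/-! ## 3. The bridge to `P2.p2Entry` (columns without labels) -/

section Bridge

variable (Θ : Anchor h → ℂ) (Φ Ψ : Anchor h → Fin h → ℂ)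

/-- The parameter point reading the `x`-tails `Φ` (other coordinates are irrelevant for `xPart`). -/
def phiPoint : Param h → ℂ
  | Sum.inl _ => 0
  | Sum.inr (Sum.inl q) => Φ q.1 q.2
  | Sum.inr (Sum.inr _) => 0

/-- The symbolic `x`-part evaluates to `xPartE`. -/
theorem map_phiPoint_xPart (α : Anchor h) : MvPolynomial.map (eval (phiPoint Φ)) (AnchorSets.xPart α) = xPartE Φ α := by
  rw [AnchorSets.xPart, xPartE, tailE, map_mul, map_prod, map_prod]
  congr 1
  · exact Finset.prod_congr rfl (fun a _ => map_X _ _)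
  · refine Finset.prod_congr rfl (fun b _ => ?_)
    rw [map_add, map_one, map_mul, map_C, map_X, eval_X]
    rfl

/-- **The `x`-reading of an anchor set is `P2.xcE`.** -/
theorem coeff_prod_xPartE (U : Finset (Fin h)) (J : Finset (Anchor h)) :
    coeff (pexpo U ∅) (∏ α ∈ J, xPartE Φ α) = P2.xcE Φ U J := by
  classical
  have hmap : (∏ α ∈ J, xPartE Φ α) = MvPolynomial.map (eval (phiPoint Φ)) (∏ α ∈ J, AnchorSets.xPart α) := by
    rw [map_prod]; exact Finset.prod_congr rfl (fun α _ => (map_phiPoint_xPart Φ α).symm)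
  rw [hmap, coeff_map, ← AnchorSets.xcoeff, AnchorSets.xcoeff_eq, P2.xcE]
  by_cases hc : (J : Set (Anchor h)).PairwiseDisjoint Prod.fst ∧ AnchorSets.xFoot J ⊆ U
  · rw [if_pos hc, if_pos hc, map_prod]
    refine Finset.prod_congr rfl (fun b _ => ?_)
    rw [map_sum]
    exact Finset.sum_congr rfl (fun α _ => by rw [eval_X]; rfl)
  · rw [if_neg hc, if_neg hc, map_zero]

/-- **BRIDGE: a column without labels reads the profile-2 dominant entry** `P2.p2Entry` of `…P2Reduction`. -/
theorem entry_empty_labels (U W : Finset (Fin h)) : entry Θ Φ Ψ U ((∅ : Finset (Anchor h)), W) = P2.p2Entry Θ Φ W U := by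
  classical
  rw [entry, colE, Finset.prod_empty, one_mul, tW, coeff_sum, P2.p2Entry, jSet]
  refine Finset.sum_congr rfl (fun J _ => ?_)
  rw [coeff_C_mul, coeff_prod_xPartE Φ U J]

end Bridge

/-! ## 4. Symbolic parameters and generic simultaneity -/

section Symbolic

/-- Symbolic anchor weights: `Θˢ α = θ_α`. -/
def thetaS : Anchor h → MvPolynomial (Param h) ℂ := fun α => X (Sum.inl α)

/-- Symbolic anchor tails: `Φˢ α b = φ_{α b}`. -/
def phiS : Anchor h → Fin h → MvPolynomial (Param h) ℂ := fun α b => X (Sum.inr (Sum.inl (α, b)))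

/-- Symbolic label tails: `Ψˢ ℓ b = ψ_{ℓ b}` (the third block of `Param h` is free here: no `y`-tails occur in the dominant problem). -/
def psiS : Anchor h → Fin h → MvPolynomial (Param h) ℂ := fun ℓ b => X (Sum.inr (Sum.inr (ℓ, b)))

/-- The point of the parameter space with coordinates `(Θ, Φ, Ψ)`. -/
def lpoint (Θ : Anchor h → ℂ) (Φ Ψ : Anchor h → Fin h → ℂ) : Param h → ℂ
  | Sum.inl α => Θ α
  | Sum.inr (Sum.inl q) => Φ q.1 q.2
  | Sum.inr (Sum.inr q) => Ψ q.1 q.2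

variable (Θ : Anchor h → ℂ) (Φ Ψ : Anchor h → Fin h → ℂ)

/-- **Symbolic entries evaluate to entries.** -/
theorem eval_entryS (U : Finset (Fin h)) (c : LCol h) :
    eval (lpoint Θ Φ Ψ) (entry thetaS phiS psiS U c) = entry Θ Φ Ψ U c := by
  rw [map_entry]
  congr 1 <;> funext <;> simp only [thetaS, phiS, psiS, eval_X] <;> rfl

/-- The labelled matrix of the enumerations `u` (rows) and `κ` (columns). -/
def lmat {n : ℕ} {K : Type*} [CommRing K] (Θ : Anchor h → K) (Φ Ψ : Anchor h → Fin h → K) (u : Fin n → Finset (Fin h)) (κ : Fin n → LCol h) :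
    Matrix (Fin n) (Fin n) K :=
  Matrix.of fun i j => entry Θ Φ Ψ (u i) (κ j)

/-- The determinant of the labelled matrix is the evaluation of the symbolic one. -/
theorem eval_det_lmatS {n : ℕ} (u : Fin n → Finset (Fin h)) (κ : Fin n → LCol h) :
    eval (lpoint Θ Φ Ψ) (lmat thetaS phiS psiS u κ).det = (lmat Θ Φ Ψ u κ).det := by
  rw [RingHom.map_det]
  congr 1
  ext i j
  rw [RingHom.mapMatrix_apply, Matrix.map_apply, lmat, lmat, Matrix.of_apply, Matrix.of_apply, eval_entryS]

/-- A nonsingular labelled matrix makes the symbolic determinant a nonzero polynomial. -/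
theorem det_lmatS_ne_zero {n : ℕ} (u : Fin n → Finset (Fin h)) (κ : Fin n → LCol h) (hdet : (lmat Θ Φ Ψ u κ).det ≠ 0) :
    (lmat thetaS phiS psiS u κ).det ≠ 0 := by
  intro h0
  apply hdet
  rw [← eval_det_lmatS, h0, map_zero]

/-- **GENERIC SIMULTANEITY.** Two enumerated square systems, each nonsingular for some parameters, are nonsingular for common parameters. -/
theorem exists_common_point {n₀ n₁ : ℕ} (u₀ : Fin n₀ → Finset (Fin h)) (κ₀ : Fin n₀ → LCol h) (u₁ : Fin n₁ → Finset (Fin h)) (κ₁ : Fin n₁ → LCol h)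
    (h₀ : ∃ (Θ : Anchor h → ℂ) (Φ Ψ : Anchor h → Fin h → ℂ), (lmat Θ Φ Ψ u₀ κ₀).det ≠ 0)
    (h₁ : ∃ (Θ : Anchor h → ℂ) (Φ Ψ : Anchor h → Fin h → ℂ), (lmat Θ Φ Ψ u₁ κ₁).det ≠ 0) :
    ∃ (Θ : Anchor h → ℂ) (Φ Ψ : Anchor h → Fin h → ℂ), (lmat Θ Φ Ψ u₀ κ₀).det ≠ 0 ∧ (lmat Θ Φ Ψ u₁ κ₁).det ≠ 0 := by
  obtain ⟨Θ₀, Φ₀, Ψ₀, hd₀⟩ := h₀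
  obtain ⟨Θ₁, Φ₁, Ψ₁, hd₁⟩ := h₁
  have hprod : (lmat thetaS phiS psiS u₀ κ₀).det * (lmat thetaS phiS psiS u₁ κ₁).det ≠ 0 :=
    mul_ne_zero (det_lmatS_ne_zero Θ₀ Φ₀ Ψ₀ u₀ κ₀ hd₀) (det_lmatS_ne_zero Θ₁ Φ₁ Ψ₁ u₁ κ₁ hd₁)
  have hpt : ∃ p : Param h → ℂ, eval p ((lmat thetaS phiS psiS u₀ κ₀).det * (lmat thetaS phiS psiS u₁ κ₁).det) ≠ 0 := by
    by_contra hall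
    exact hprod (MvPolynomial.funext (fun p => by rw [map_zero]; exact not_not.mp (fun hne => hall ⟨p, hne⟩)))
  obtain ⟨p, hp⟩ := hpt
  rw [map_mul] at hp
  -- read the point back as `(Θ, Φ, Ψ)`
  have hpt_eq : lpoint (fun α => p (Sum.inl α)) (fun α b => p (Sum.inr (Sum.inl (α, b)))) (fun ℓ b => p (Sum.inr (Sum.inr (ℓ, b)))) = p := by
    funext q
    rcases q with α | q | q <;> rfl
  refine ⟨fun α => p (Sum.inl α), fun α b => p (Sum.inr (Sum.inl (α, b))), fun ℓ b => p (Sum.inr (Sum.inr (ℓ, b))), ?_, ?_⟩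
  · rw [← eval_det_lmatS, hpt_eq]; exact left_ne_zero_of_mul hp
  · rw [← eval_det_lmatS, hpt_eq]; exact right_ne_zero_of_mul hp

end Symbolic

/-! ## 5. Re-enumeration: nonsingularity does not depend on the enumerations -/

/-- **Re-enumerating rows and columns (same ranges, injective) preserves nonsingularity.** -/
theorem det_lmat_ne_zero_of_range_eq {n n' : ℕ} {K : Type*} [CommRing K] [IsDomain K] (Θ : Anchor h → K) (Φ Ψ : Anchor h → Fin h → K)
    {u : Fin n → Finset (Fin h)} {κ : Fin n → LCol h} {u' : Fin n' → Finset (Fin h)} {κ' : Fin n' → LCol h}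
    (hu : Function.Injective u) (hκ' : Function.Injective κ')
    (hru : Set.range u' = Set.range u) (hrκ : Set.range κ' = Set.range κ) (hn : n = n')
    (hdet : (lmat Θ Φ Ψ u κ).det ≠ 0) : (lmat Θ Φ Ψ u' κ').det ≠ 0 := by
  classical
  subst hn
  -- row permutation σ with u' = u ∘ σ, column permutation τ with κ = κ' ∘ τ
  have hrow : ∀ i, ∃ i₀, u i₀ = u' i := fun i => by
    have : u' i ∈ Set.range u := by rw [← hru]; exact ⟨i, rfl⟩
    exact this
  choose σ hσ using hrow
  have hσinj : Function.Injective σ := fun i i' hii => by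
    have hu' : Function.Injective u' := by
      intro a b hab
      -- u' injective: it enumerates the same finite set of the same size as the injective u
      have hcard : (Finset.univ.image u').card = n := by
        have h1 : Finset.univ.image u' = Finset.univ.image u := by
          ext U; simp only [Finset.mem_image, Finset.mem_univ, true_and]
          constructor
          · rintro ⟨i, rfl⟩; exact hru.le ⟨i, rfl⟩
          · rintro ⟨i, rfl⟩; exact hru.ge ⟨i, rfl⟩
        rw [h1, Finset.card_image_of_injective _ hu, Finset.card_univ, Fintype.card_fin]
      have := Finset.card_image_iff.mp (by rw [hcard, Finset.card_univ, Fintype.card_fin])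
      exact this (Finset.mem_coe.mpr (Finset.mem_univ a)) (Finset.mem_coe.mpr (Finset.mem_univ b)) hab
    exact hu' (by rw [← hσ i, ← hσ i', hii])
  have hcol : ∀ j, ∃ j₀, κ' j₀ = κ j := fun j => by
    have : κ j ∈ Set.range κ' := by rw [hrκ]; exact ⟨j, rfl⟩
    exact this
  choose τ hτ using hcol
  have hτinj : Function.Injective τ := fun j j' hjj => by
    have hκ : Function.Injective κ := by
      intro a b hab
      have hcard : (Finset.univ.image κ).card = n := by
        have h1 : Finset.univ.image κ = Finset.univ.image κ' := by
          ext c; simp only [Finset.mem_image, Finset.mem_univ, true_and]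
          constructor
          · rintro ⟨i, rfl⟩; exact hrκ.ge ⟨i, rfl⟩
          · rintro ⟨i, rfl⟩; exact hrκ.le ⟨i, rfl⟩
        rw [h1, Finset.card_image_of_injective _ hκ', Finset.card_univ, Fintype.card_fin]
      have := Finset.card_image_iff.mp (by rw [hcard, Finset.card_univ, Fintype.card_fin])
      exact this (Finset.mem_coe.mpr (Finset.mem_univ a)) (Finset.mem_coe.mpr (Finset.mem_univ b)) hab
    exact hκ (by rw [← hτ j, ← hτ j', hjj])
  let eσ : Equiv.Perm (Fin n) := Equiv.ofBijective σ (Finite.injective_iff_bijective.mp hσinj)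
  let eτ : Equiv.Perm (Fin n) := Equiv.ofBijective τ (Finite.injective_iff_bijective.mp hτinj)
  -- lmat u' κ' with columns permuted by τ is lmat u κ with rows permuted by σ
  have hM : (lmat Θ Φ Ψ u' κ').submatrix id eτ = (lmat Θ Φ Ψ u κ).submatrix eσ id := by
    ext i j
    simp only [Matrix.submatrix_apply, lmat, Matrix.of_apply, id]
    rw [show (eτ j : Fin n) = τ j from rfl, show (eσ i : Fin n) = σ i from rfl, hτ, hσ]
  intro h0
  apply hdet
  have h1 : ((lmat Θ Φ Ψ u κ).submatrix eσ id).det = 0 := by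
    rw [← hM, Matrix.det_permute', h0, mul_zero]
  rw [Matrix.det_permute] at h1
  rcases mul_eq_zero.mp h1 with hs | hd
  · exact absurd hs (by
      have := Int.units_eq_one_or (Equiv.Perm.sign eσ)
      rcases this with h1' | h1' <;> simp [h1'])
  · exact hd

end XElim

end

end Summit.ValiantsHypothesis.ValiantsHypothesis.Theorems.BarrierLever.AnchoredPeeling
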